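import Mathlib

/-!
# Tier4/LitKK — Konno–Konno, *On doubling construction for real unitary dual pairs*, Kyushu J. Math. 61 (2007)
35–82: Theorem 5.4 (the K-type correspondence), AS PRINTED

Blind re-derivation cell `pub-hodge-repro`, Tier 4 (README §9–§10), seat `t4-lit-2` (gen 0), family = the identification
cluster (STATUS S11855 / S11858 / S11865).  Target tree path `lean/Summits/Ventures/HodgeRepro/Tier4/LitKK.lean`.  Every
`def … : Prop` below is a PRINTED statement typed with its hypotheses explicit over a small interface (`KKSetting`); NO
published theorem is proved here (seat rule).  Statement-exact quotes with page/line: HOME/proofs/t4/inputs/t4-lit-2.md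
rows I-t4-lit-2-11 … -14 (the journal print, HOME/lit-deposits/KonnoKonno2007-kyushujm61, sha256 0cfb3a73914b59b9…; page
layer lit/t3-lit-g3-extract/KonnoKonno2007-kyushujm61/pdfNNN.txt, PDF page NNN = printed page NNN + 34; the operator's
renders p074–p076 = pdf040–042).

**Why this statement.**  The archimedean input (E5) of route/TIER3.md §1 item 3 (residual R-D′) — which K-types of the
real unitary dual pair `(U(p,q), U(p′,q′))` occur in the joint harmonics of the Weil representation and how they
correspond — is what the lines' «admissible at ∞» predicates pin (t4-plan-1 S11892 L1.5 / S11966 L1.4 (b), the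
`(2,0)`-K-type of the lift at the `(2,1)` place and the finite-dimensional types at the definite places).  The tree's
`LitKType.Correspond` (seat lit-2 gen 4) types the SAME correspondence as printed by Ichino (arXiv:2002.09148 Lemma 7.8 /
Adv. Math. 2022 Lemma 7.10, whose proof says «the assertion follows from [konno]», with a convention switch
`g ↦ ᵗg⁻¹`); this file types Konno–Konno's OWN display, in Konno–Konno's letters, so that a line quoting [KK07, Thm 5.4]
(as Liu 2021 Lemma D.2 does — t4-lit-5 row I-t4-lit-5-29) has the printed sentence by name.  The relation between the two
parametrisations is NOT asserted here.

**Setting (§3.1, p. 43 L13–L34 = pdf009; p. 44 L2–L4 = pdf010; §4 p. 49 L19–L21 = pdf015, VERBATIM).**  «Let (V, (·,·)) be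
an n-dimensional hermitian space over ℂ […] (z, z′) = z* I_{p,q} z′, I_{p,q} = diag(1_p, −1_q), p + q = n. Thus, the unitary
group G_V […] is isomorphic to U(p,q) […] (W, ⟨·,·⟩) denotes a non-degenerate n′-dimensional skew-hermitian space over ℂ
[…] We call (p′,q′) the signature of (W, ⟨·,·⟩). The unitary group G_W […] is realized as U(p′,q′)»; «The character pair
ξ = (ξ, ξ′) can be written as ξ(z) = (z/z̄)^{m/2}, ξ′(z) = (z/z̄)^{m′/2}, m ≡ n′, m′ ≡ n (mod 2) ∈ ℤ.»  (`m`, `m′` are the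
parameters of the two SPLITTING CHARACTERS, not dimensions — t3-p1 PERIOD-ADDENDUM-7.md §A7.0 (2).)  Weights (p. 74
L7–L21 = pdf040): «We take a basis {e_1, …, e_p, ē_1, …, ē_q} of 𝔱*_{V,ℂ} as e_i(diag(t_1, …, t_n)) := t_i,
ē_i(diag(t_1, …, t_n)) := t_{p+i} and identify 𝔱*_{V,ℂ} with ℂ^n by this. We write {e′_1, …, e′_{p′}; ē′_1, …, ē′_{q′}} for
the analogous basis for 𝔱*_{W,ℂ}.»  Borels (p. 75 L22–L27 = pdf041): «Recall the sign ε_ψ = dψ/(|dψ| i) ∈ {±1}. We set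
(𝔟_{V,ψ}, 𝔟_{W,ψ}) := (𝔟̄_V, 𝔟_W) if ε_ψ = 1, (𝔟_V, 𝔟̄_W) if ε_ψ = −1.»

**Theorem 5.4 (K-type correspondence) (p. 75 L28–L69 = pdf041, VERBATIM).** «We have the following. (i) Write the
𝔟_{V,ψ}-highest weight of a K_V-type τ_V as
  (m/2, …, m/2; m/2, …, m/2) + ε_ψ((q′−p′)/2, …, (q′−p′)/2; (p′−q′)/2, …, (p′−q′)/2)
    + ε_ψ(−a_1, …, −a_r, 0, …, 0, b_s, …, b_1; −d_1, …, −d_u, 0, …, 0, c_t, …, c_1),   (5.6)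
for some a_1 ≥ ⋯ ≥ a_r, b_1 ≥ ⋯ ≥ b_s, c_1 ≥ ⋯ ≥ c_t, d_1 ≥ ⋯ ≥ d_u ∈ ℤ_{>0}. Then τ_V belongs to ℛ(K_V, 𝒥_{V,W,ξ}) if and
only if r + t ≤ p′, s + u ≤ q′. In that case, the 𝔟_{W,ψ}-highest weight of θ_ξ(τ_V, K_W) is given by
  (m′/2, …, m′/2; m′/2, …, m′/2) + ε_ψ((p−q)/2, …, (p−q)/2; (q−p)/2, …, (q−p)/2)
    + ε_ψ(a_1, …, a_r, 0, …, 0, −c_t, …, −c_1; d_1, …, d_u, 0, …, 0, −b_s, …, −b_1).   (5.7)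
(ii) Conversely, a K_W-type τ_W with the 𝔟_{W,ψ}-highest weight (5.7) belongs to ℛ(K_W, 𝒥_{V,W,ξ}) if and only if
r + s ≤ p, t + u ≤ q. In that case, θ_ξ(τ_W, K_V) has the 𝔟_{V,ψ}-highest weight (5.6).»

**What is typed.**  Mathlib has no Fock model / joint harmonics, so `ℛ(K_V, 𝒥_{V,W,ξ})` («τ_V occurs in the joint
harmonics») and `θ_ξ(τ_V, K_W)` are interface fields (`occursV`, `thetaV`, …); the highest weights are `List ℚ × List ℚ`
(the `p` entries on `e_1, …, e_p`, then the `q` entries on `ē_1, …, ē_q`; half-integers allowed, `m/2` need not be an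
integer); the displays (5.6) / (5.7) are the functions `form56` / `form57` of the four positive antitone lists
`a, b, c, d` (lengths `r, s, t, u`) — the zeros in the middle pad the block to its length, which presupposes
`r + s ≤ p`, `t + u ≤ q` in (5.6) and `r + t ≤ p′`, `s + u ≤ q′` in (5.7), exactly the conditions the theorem names.
Every field is a parameter.  Nothing here says anything about the status of the Hodge conjecture for CM abelian
varieties, which is NOT proved (HC_CM is NOT proved by anyone in this repository).
-/

set_option autoImplicit false

noncomputable section

namespace Summit.Ventures.HodgeRepro.Tier4.Lit

namespace KK

/-- A list `a_1 ≥ ⋯ ≥ a_r` of POSITIVE integers («a_1 ≥ ⋯ ≥ a_r ∈ ℤ_{>0}»). -/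
def PosAntitone (a : List ℤ) : Prop := a.Pairwise (· ≥ ·) ∧ ∀ x ∈ a, 0 < x

/-- The block `(x_1, …, x_k, 0, …, 0, y_l, …, y_1)` of length `len` (zeros pad the middle; the reversal writes
`y_l, …, y_1` as printed). -/
def block (len : ℕ) (x y : List ℤ) : List ℚ :=
  (x.map (fun z : ℤ => (z : ℚ))) ++ List.replicate (len - x.length - y.length) (0 : ℚ) ++
    (y.reverse.map (fun z : ℤ => (z : ℚ)))

/-- Add the constant `c` to every entry of a block. -/
def shift (c : ℚ) (l : List ℚ) : List ℚ := l.map (fun x => c + x)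

/-- Multiply every entry of a block by `ε`. -/
def scale (ε : ℚ) (l : List ℚ) : List ℚ := l.map (fun x => ε * x)

/-- **The display (5.6)**: the `𝔟_{V,ψ}`-highest weight
`(m/2, …; m/2, …) + ε_ψ((q′−p′)/2, …; (p′−q′)/2, …) + ε_ψ(−a_1, …, −a_r, 0, …, 0, b_s, …, b_1; −d_1, …, −d_u, 0, …, 0, c_t, …, c_1)`
as a pair (the `p` entries on `e_i`; the `q` entries on `ē_i`). -/
def form56 (p q p' q' : ℕ) (m : ℤ) (ε : ℚ) (a b c d : List ℤ) : List ℚ × List ℚ :=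
  (shift ((m : ℚ) / 2 + ε * (((q' : ℚ) - p') / 2)) (scale ε (block p (a.map Neg.neg) b)),
   shift ((m : ℚ) / 2 + ε * (((p' : ℚ) - q') / 2)) (scale ε (block q (d.map Neg.neg) c)))

/-- **The display (5.7)**: the `𝔟_{W,ψ}`-highest weight
`(m′/2, …; m′/2, …) + ε_ψ((p−q)/2, …; (q−p)/2, …) + ε_ψ(a_1, …, a_r, 0, …, 0, −c_t, …, −c_1; d_1, …, d_u, 0, …, 0, −b_s, …, −b_1)`
as a pair (the `p′` entries on `e′_i`; the `q′` entries on `ē′_i`). -/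
def form57 (p q p' q' : ℕ) (m' : ℤ) (ε : ℚ) (a b c d : List ℤ) : List ℚ × List ℚ :=
  (shift ((m' : ℚ) / 2 + ε * (((p : ℚ) - q) / 2)) (scale ε (block p' a (c.map Neg.neg))),
   shift ((m' : ℚ) / 2 + ε * (((q : ℚ) - p) / 2)) (scale ε (block q' d (b.map Neg.neg))))

/-- **The setting of Konno–Konno §3–§5 as an interface**: the signatures `(p, q)` of `V` and `(p′, q′)` of `W`, the
splitting-character parameters `m ≡ p′ + q′`, `m′ ≡ p + q (mod 2)`, the sign `ε_ψ ∈ {±1}`, the `K_V`- and `K_W`-types with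
their `𝔟_{V,ψ}`- resp. `𝔟_{W,ψ}`-highest weights, the occurrence predicates `τ ∈ ℛ(K, 𝒥_{V,W,ξ})` and the theta
correspondence of K-types `θ_ξ(τ_V, K_W)`, `θ_ξ(τ_W, K_V)`.  Every field is a parameter. -/
structure KKSetting where
  /-- the signature `(p, q)` of the hermitian space `V`, `n = p + q` -/
  p : ℕ
  q : ℕ
  /-- the signature `(p′, q′)` of the skew-hermitian space `W`, `n′ = p′ + q′` -/
  p' : ℕ
  q' : ℕ
  /-- `ξ(z) = (z/z̄)^{m/2}`, `m ≡ n′ (mod 2)` -/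
  m : ℤ
  m_parity : m % 2 = ((p' + q' : ℕ) : ℤ) % 2
  /-- `ξ′(z) = (z/z̄)^{m′/2}`, `m′ ≡ n (mod 2)` -/
  m' : ℤ
  m'_parity : m' % 2 = ((p + q : ℕ) : ℤ) % 2
  /-- `ε_ψ = dψ/(|dψ| i) ∈ {±1}` -/
  eps : ℚ
  eps_sq : eps = 1 ∨ eps = -1
  /-- the `K_V`-types -/
  KVType : Type
  /-- the `K_W`-types -/
  KWType : Type
  /-- the `𝔟_{V,ψ}`-highest weight of a `K_V`-type (`p` entries; `q` entries) -/
  hwV : KVType → List ℚ × List ℚ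
  /-- the `𝔟_{W,ψ}`-highest weight of a `K_W`-type (`p′` entries; `q′` entries) -/
  hwW : KWType → List ℚ × List ℚ
  /-- `τ_V ∈ ℛ(K_V, 𝒥_{V,W,ξ})` -/
  occursV : KVType → Prop
  /-- `τ_W ∈ ℛ(K_W, 𝒥_{V,W,ξ})` -/
  occursW : KWType → Prop
  /-- `θ_ξ(τ_V, K_W)` -/
  thetaV : KVType → KWType
  /-- `θ_ξ(τ_W, K_V)` -/
  thetaW : KWType → KVType

/-- The four lists `a, b, c, d` are positive antitone («a_1 ≥ ⋯ ≥ a_r, …, d_1 ≥ ⋯ ≥ d_u ∈ ℤ_{>0}»). -/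
def Admissible (a b c d : List ℤ) : Prop := PosAntitone a ∧ PosAntitone b ∧ PosAntitone c ∧ PosAntitone d

namespace KKSetting

variable (S : KKSetting)

/-- **Theorem 5.4 (i), AS PRINTED** (Kyushu J. Math. 61 (2007) p. 75 L28–L64; row I-t4-lit-2-12): for a `K_V`-type `τ_V`
whose `𝔟_{V,ψ}`-highest weight is written as (5.6) with positive antitone `a, b, c, d` of lengths `r, s, t, u` (the
writing presupposes `r + s ≤ p`, `t + u ≤ q`): «τ_V belongs to ℛ(K_V, 𝒥_{V,W,ξ}) if and only if r + t ≤ p′, s + u ≤ q′.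
In that case, the 𝔟_{W,ψ}-highest weight of θ_ξ(τ_V, K_W) is given by (5.7).» -/
def KonnoKonno2007_Thm5_4_i : Prop :=
  ∀ (τV : S.KVType) (a b c d : List ℤ), Admissible a b c d →
    a.length + b.length ≤ S.p → d.length + c.length ≤ S.q →
    S.hwV τV = form56 S.p S.q S.p' S.q' S.m S.eps a b c d →
      (S.occursV τV ↔ a.length + c.length ≤ S.p' ∧ b.length + d.length ≤ S.q') ∧
      (S.occursV τV → S.hwW (S.thetaV τV) = form57 S.p S.q S.p' S.q' S.m' S.eps a b c d)

/-- **Theorem 5.4 (ii), AS PRINTED** (p. 75 L65–L69): «Conversely, a K_W-type τ_W with the 𝔟_{W,ψ}-highest weight (5.7)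
belongs to ℛ(K_W, 𝒥_{V,W,ξ}) if and only if r + s ≤ p, t + u ≤ q. In that case, θ_ξ(τ_W, K_V) has the 𝔟_{V,ψ}-highest
weight (5.6).» -/
def KonnoKonno2007_Thm5_4_ii : Prop :=
  ∀ (τW : S.KWType) (a b c d : List ℤ), Admissible a b c d →
    a.length + c.length ≤ S.p' → b.length + d.length ≤ S.q' →
    S.hwW τW = form57 S.p S.q S.p' S.q' S.m' S.eps a b c d →
      (S.occursW τW ↔ a.length + b.length ≤ S.p ∧ d.length + c.length ≤ S.q) ∧
      (S.occursW τW → S.hwV (S.thetaW τW) = form56 S.p S.q S.p' S.q' S.m S.eps a b c d)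

/-- **Theorem 5.4 as one statement**: (i) ∧ (ii). -/
def KonnoKonno2007_Thm5_4 : Prop := S.KonnoKonno2007_Thm5_4_i ∧ S.KonnoKonno2007_Thm5_4_ii

/-- **The instance of (P) at the distinguished place**: `V` of signature `(2, 1)` and `W` a LINE (`p′ + q′ = 1`) — the
pair `(U(2,1), U(1))` of a corner's theta lift. -/
def IsMixedLinePair : Prop := S.p = 2 ∧ S.q = 1 ∧ S.p' + S.q' = 1

/-- **The instance at a definite place**: `V` of signature `(3, 0)` and `W` a line. -/
def IsDefiniteLinePair : Prop := S.p = 3 ∧ S.q = 0 ∧ S.p' + S.q' = 1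

/-- **Composition (no published content)**: for the `K_V`-trivial shape `a = b = c = d = []` the displayed weight (5.6) is
the constant vector `(m/2 + ε(q′−p′)/2, …; m/2 + ε(p′−q′)/2, …)`, and by Theorem 5.4 (i) it occurs (`0 + 0 ≤ p′`,
`0 + 0 ≤ q′`), with `θ_ξ` of the constant weight `(m′/2 + ε(p−q)/2, …; m′/2 + ε(q−p)/2, …)` — the «vacuum» row of the
cell's slot bookkeeping (t3-p1 PERIOD-ADDENDUM-7.md §A7.0 (4)). -/
theorem occurs_of_form56_nil (h : S.KonnoKonno2007_Thm5_4_i) (τV : S.KVType)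
    (hτ : S.hwV τV = form56 S.p S.q S.p' S.q' S.m S.eps [] [] [] []) :
    S.occursV τV ∧ S.hwW (S.thetaV τV) = form57 S.p S.q S.p' S.q' S.m' S.eps [] [] [] [] := by
  have hadm : Admissible [] [] [] [] := by
    refine ⟨?_, ?_, ?_, ?_⟩ <;> exact ⟨List.Pairwise.nil, fun x hx => by simp at hx⟩
  obtain ⟨hiff, hw⟩ := h τV [] [] [] [] hadm (by simp) (by simp) hτ
  have hocc : S.occursV τV := hiff.2 ⟨by simp, by simp⟩
  exact ⟨hocc, hw hocc⟩

end KKSetting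

end KK

end Summit.Ventures.HodgeRepro.Tier4.Lit

end
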